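import Summits.Ventures.Crystal3D.Theorems.StickyWulffConstantTextureLiminfTexShadowRimSaturation
import HarnessLib

/-!
# Level-ledger vocabulary of the terrace census in CHAIN currency: located chain ends, launch sets, and the injective count
# (lane T, crux `TextureLiminfV5`, stmt-Ventures-23912, registered stub `stub_terraceCensus`; cf-p1 RULING (ccxli) inputs (I2)/(I4); 19480-p1 g18)

HONEST FRAMING. Venture `Summits/Ventures/Crystal3D` (cell `crystal3d-full`), route `route-Ventures-StickyWulffConstant`, helper `--supports` the
law-v5 crux `TextureLiminfV5` (stmt-Ventures-23912), lane T, line `TexShadow` v8.19R, mechanism (β) in the LEDGER architecture of record (ruling (ccxli):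
«n-level walker + slab pinning», memo BETA-ASSEMBLY-g18 rev 2 §6).  DEFINITIONS + one combinatorial counting lemma; LATTICE-FREE (no plate, no frame, no
certificate); nothing about energies is asserted; F-C1 not moved.

THE POINT (what the level ledger counts, stated so that 19481-p1's O3 «launch → push → block» and my (I3)/(I6) meet on fixed predicates).
Fix a unit vector `c` (an in-plane slot class of the letter's plane, `0 < ⟪c, e₃⟫`).  A `c`-CHAIN of a configuration `X` is a maximal string
`b, b + c, b + 2c, …` of balls of `X`; its TOP END `e` is LOCATED: `e ∈ X`, `e − c ∈ X`, `e + c ∉ X` (`chainTopEnds`), its BOTTOM BEGINNING likewise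
(`chainBottomBegins`).  No lattice is mentioned: the chains of a translated or twinned coset are chains too (this is what survives complete twin bands,
memo §6 / (I5)).  A LAUNCH SET `S ⊆ X` for `c` (`IsLaunchSet`) is a set of balls each with its successor `b + c ∈ X` and no two on a common `c`-line; the
count lemma `card_le_card_chainTopEnds` says: if no ball strictly above height `zhi` has a successor (BLOCKING — supplied by plate 2's complete slab
when `c` is not a slot of plate 2's lattice, 19481-p1), then the top ends of the chains through `S` are DISTINCT located ends at heights in
`[min_S b₂, zhi + c₂]`, so `#S ≤ #chainTopEnds`.  The PAYMENT side is the dichotomy of …TexShadowRimSaturation (p731089): a located end with an exact-only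
own pattern and the empty slot `e + c` has `≤ 11` contacts (PAYS `½`) unless its contact shell is a close-packed dozen not containing `e + c` — a TWIN
READING on a plane not containing `c` (`sum_deficiency_ge_card_sub_card_reads` records the bookkeeping: `Σ_ends (12 − deg) ≥ #ends − #reads`).
What the census then owes (my (I3)/(I6)): reads of `c`-chains of the letter-`k` lattice never lie on the letter plane `n_k ∋ c`; the pinning (p730052) and
the column word (I5, 19480-p2) bound the reads; the launch count per class is `√2 ⟪c,e₃⟫ π(ρ−1)² − rim` (19481-p1's line count).
* `chainTopEnds X c W`, `chainBottomBegins X c W` (Finsets, window predicate `W`), `mem_chainTopEnds`;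
* `IsLaunchSet X c S`; `chainTop` (the top end of the chain through a launched ball, by `Nat.find`), `chainTop_mem_chainTopEnds`, `chainTop_injOn`;
* **`card_le_card_chainTopEnds`** — `#S ≤ #(chainTopEnds X c (heights ∈ [zlo, zhi + c 2]))` under blocking above `zhi` and `S` at heights `≥ zlo`;
* `sum_deficiency_ge_card_sub_card_reads` — `Σ_{e ∈ E} (12 − deg e) ≥ #E − #{e ∈ E : deg e = 12}` for any finite set `E` of centres (degrees taken in a `1`-separated `X`).
WHAT THIS IS NOT: the line count, the blocking lemma, the read bound, or any energy statement; F-C1 not moved.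
-/

noncomputable section

open scoped BigOperators

namespace Summit.Ventures.Crystal3D.Cruxes.TextureLiminf.TexShadow

open Finset Summit.Ventures.Crystal3D.Theorems

/-! ## Located chain ends and beginnings -/

open scoped Classical in
/-- **Located TOP ENDS of `c`-chains** of `X` satisfying the window predicate `W`: `e ∈ X`, `e − c ∈ X`, `e + c ∉ X`. -/
def chainTopEnds (X : Finset (EuclideanSpace ℝ (Fin 3))) (c : EuclideanSpace ℝ (Fin 3)) (W : EuclideanSpace ℝ (Fin 3) → Prop) :
    Finset (EuclideanSpace ℝ (Fin 3)) :=
  X.filter fun e => e - c ∈ X ∧ e + c ∉ X ∧ W e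

open scoped Classical in
/-- **Located BOTTOM BEGINNINGS of `c`-chains** of `X` satisfying `W`: `b ∈ X`, `b + c ∈ X`, `b − c ∉ X`. -/
def chainBottomBegins (X : Finset (EuclideanSpace ℝ (Fin 3))) (c : EuclideanSpace ℝ (Fin 3)) (W : EuclideanSpace ℝ (Fin 3) → Prop) :
    Finset (EuclideanSpace ℝ (Fin 3)) :=
  X.filter fun b => b + c ∈ X ∧ b - c ∉ X ∧ W b

open scoped Classical in
/-- Membership in `chainTopEnds`. -/
theorem mem_chainTopEnds {X : Finset (EuclideanSpace ℝ (Fin 3))} {c : EuclideanSpace ℝ (Fin 3)} {W : EuclideanSpace ℝ (Fin 3) → Prop}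
    {e : EuclideanSpace ℝ (Fin 3)} : e ∈ chainTopEnds X c W ↔ e ∈ X ∧ e - c ∈ X ∧ e + c ∉ X ∧ W e := by
  rw [chainTopEnds, mem_filter]

open scoped Classical in
/-- Membership in `chainBottomBegins`. -/
theorem mem_chainBottomBegins {X : Finset (EuclideanSpace ℝ (Fin 3))} {c : EuclideanSpace ℝ (Fin 3)} {W : EuclideanSpace ℝ (Fin 3) → Prop}
    {b : EuclideanSpace ℝ (Fin 3)} : b ∈ chainBottomBegins X c W ↔ b ∈ X ∧ b + c ∈ X ∧ b - c ∉ X ∧ W b := by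
  rw [chainBottomBegins, mem_filter]

/-! ## Launch sets and the top of a chain -/

/-- **LAUNCH SET for the class `c`**: balls of `X` each having its successor `b + c` in `X`, no two on a common `c`-line
(`b' = b + k c`, `k ∈ ℤ` ⇒ `b' = b`). -/
def IsLaunchSet (X : Finset (EuclideanSpace ℝ (Fin 3))) (c : EuclideanSpace ℝ (Fin 3)) (S : Finset (EuclideanSpace ℝ (Fin 3))) : Prop :=
  S ⊆ X ∧ (∀ b ∈ S, b + c ∈ X) ∧ ∀ b ∈ S, ∀ b' ∈ S, ∀ k : ℤ, b' = b + (k : ℝ) • c → b' = b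

/-- Along a nonzero direction the points `b + m c` are pairwise distinct. -/
theorem add_smul_injective {c : EuclideanSpace ℝ (Fin 3)} (hc : c ≠ 0) (b : EuclideanSpace ℝ (Fin 3)) :
    Function.Injective fun m : ℕ => b + (m : ℝ) • c := by
  intro m m' h
  have h1 : ((m : ℝ) - m') • c = 0 := by
    rw [sub_smul]; exact sub_eq_zero.2 (add_left_cancel h)
  rcases smul_eq_zero.1 h1 with h2 | h2
  · exact_mod_cast (sub_eq_zero.1 h2)
  · exact absurd h2 hc

/-- A chain in a finite configuration stops: some `b + (m+1) c ∉ X`. -/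
theorem exists_succ_not_mem (X : Finset (EuclideanSpace ℝ (Fin 3))) {c : EuclideanSpace ℝ (Fin 3)} (hc : c ≠ 0)
    (b : EuclideanSpace ℝ (Fin 3)) : ∃ m : ℕ, b + ((m + 1 : ℕ) : ℝ) • c ∉ X := by
  by_contra h
  push Not at h
  -- then `ℕ` injects into `X`
  have hinj : Function.Injective fun m : ℕ => (⟨b + ((m + 1 : ℕ) : ℝ) • c, h m⟩ : X) := by
    intro m m' hmm'
    have := add_smul_injective hc b (Subtype.ext_iff.1 hmm')
    omega
  exact not_injective_infinite_finite _ hinj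

open scoped Classical in
/-- The number of further steps of the chain through `b`: the least `m` with `b + (m+1) c ∉ X`. -/
def chainSteps (X : Finset (EuclideanSpace ℝ (Fin 3))) {c : EuclideanSpace ℝ (Fin 3)} (hc : c ≠ 0) (b : EuclideanSpace ℝ (Fin 3)) : ℕ :=
  Nat.find (exists_succ_not_mem X hc b)

open scoped Classical in
/-- **The top end of the chain through `b`.** -/
def chainTop (X : Finset (EuclideanSpace ℝ (Fin 3))) {c : EuclideanSpace ℝ (Fin 3)} (hc : c ≠ 0) (b : EuclideanSpace ℝ (Fin 3)) :
    EuclideanSpace ℝ (Fin 3) :=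
  b + (chainSteps X hc b : ℝ) • c

open scoped Classical in
/-- The successor of the top is not in `X`. -/
theorem chainTop_add_not_mem (X : Finset (EuclideanSpace ℝ (Fin 3))) {c : EuclideanSpace ℝ (Fin 3)} (hc : c ≠ 0) (b : EuclideanSpace ℝ (Fin 3)) :
    chainTop X hc b + c ∉ X := by
  have h := Nat.find_spec (exists_succ_not_mem X hc b)
  have e : chainTop X hc b + c = b + (((chainSteps X hc b) + 1 : ℕ) : ℝ) • c := by
    rw [chainTop, chainSteps]; push_cast; rw [add_smul, one_smul, add_assoc]
  rw [e]; exact h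

open scoped Classical in
/-- Every ball of the chain up to the top is in `X` (given `b ∈ X`). -/
theorem add_smul_mem_of_le_chainSteps (X : Finset (EuclideanSpace ℝ (Fin 3))) {c : EuclideanSpace ℝ (Fin 3)} (hc : c ≠ 0)
    {b : EuclideanSpace ℝ (Fin 3)} (hb : b ∈ X) {j : ℕ} (hj : j ≤ chainSteps X hc b) : b + (j : ℝ) • c ∈ X := by
  rcases Nat.eq_zero_or_pos j with rfl | hpos
  · simpa using hb
  · obtain ⟨i, rfl⟩ : ∃ i, j = i + 1 := ⟨j - 1, by omega⟩
    have hi : i < chainSteps X hc b := by omega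
    have h := Nat.find_min (exists_succ_not_mem X hc b) hi
    push Not at h
    exact h

open scoped Classical in
/-- **The top of the chain through a launched ball is a located top end**, at height `≥` the ball's and `≤ zhi + c 2` under blocking above `zhi`. -/
theorem chainTop_mem_chainTopEnds (X : Finset (EuclideanSpace ℝ (Fin 3))) {c : EuclideanSpace ℝ (Fin 3)} (hc : c ≠ 0) (hc2 : 0 ≤ c 2)
    {b : EuclideanSpace ℝ (Fin 3)} (hb : b ∈ X) (hbc : b + c ∈ X) {zlo zhi : ℝ} (hzlo : zlo ≤ b 2)
    (hblock : ∀ e ∈ X, zhi < e 2 → e + c ∉ X) :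
    chainTop X hc b ∈ chainTopEnds X c (fun e => zlo ≤ e 2 ∧ e 2 ≤ zhi + c 2) := by
  have hsteps : 1 ≤ chainSteps X hc b := by
    by_contra h0
    push Not at h0
    have h00 : chainSteps X hc b = 0 := by omega
    have := chainTop_add_not_mem X hc b
    rw [chainTop, h00] at this
    simp at this
    exact this hbc
  have htop : chainTop X hc b ∈ X := add_smul_mem_of_le_chainSteps X hc hb le_rfl
  have hprev : chainTop X hc b - c ∈ X := by
    have h := add_smul_mem_of_le_chainSteps X hc hb (Nat.sub_le (chainSteps X hc b) 1)
    have e : b + (((chainSteps X hc b - 1 : ℕ)) : ℝ) • c = chainTop X hc b - c := by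
      rw [chainTop, Nat.cast_sub hsteps, sub_smul, Nat.cast_one, one_smul, add_sub_assoc]
    rwa [e] at h
  refine mem_chainTopEnds.2 ⟨htop, hprev, chainTop_add_not_mem X hc b, ?_, ?_⟩
  · -- height ≥ zlo
    have : (chainTop X hc b) 2 = b 2 + (chainSteps X hc b : ℝ) * c 2 := by
      simp [chainTop]
    rw [this]
    nlinarith [Nat.cast_nonneg (α := ℝ) (chainSteps X hc b)]
  · -- height ≤ zhi + c 2: the predecessor has a successor, so it is not above zhi
    have hle : (chainTop X hc b - c) 2 ≤ zhi := by
      by_contra hlt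
      push Not at hlt
      have := hblock _ hprev hlt
      rw [sub_add_cancel] at this
      exact this htop
    have e : (chainTop X hc b - c) 2 = (chainTop X hc b) 2 - c 2 := by simp
    linarith [e ▸ hle]

open scoped Classical in
/-- **Distinct launch balls have distinct tops** (no two launch balls on a common `c`-line). -/
theorem chainTop_injOn (X : Finset (EuclideanSpace ℝ (Fin 3))) {c : EuclideanSpace ℝ (Fin 3)} (hc : c ≠ 0)
    {S : Finset (EuclideanSpace ℝ (Fin 3))} (hS : IsLaunchSet X c S) : Set.InjOn (chainTop X hc) ↑S := by
  intro b hb b' hb' h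
  simp only [chainTop] at h
  -- `b' = b + (m − m') • c`
  have e : b' = b + (((chainSteps X hc b : ℤ) - (chainSteps X hc b' : ℤ) : ℤ) : ℝ) • c := by
    push_cast
    rw [sub_smul]
    calc b' = (b' + (chainSteps X hc b' : ℝ) • c) - (chainSteps X hc b' : ℝ) • c := by simp
      _ = (b + (chainSteps X hc b : ℝ) • c) - (chainSteps X hc b' : ℝ) • c := by rw [h]
      _ = b + ((chainSteps X hc b : ℝ) • c - (chainSteps X hc b' : ℝ) • c) := by rw [add_sub_assoc]
  exact (hS.2.2 b (mem_coe.1 hb) b' (mem_coe.1 hb') _ e).symm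

open scoped Classical in
/-- **THE INJECTIVE COUNT of the level ledger.**  If `S` is a launch set for `c` (`c ≠ 0`, `c 2 ≥ 0`) at heights `≥ zlo`, and no ball strictly above
`zhi` has a successor (blocking), then `#S ≤ #(located top ends at heights in [zlo, zhi + c 2])`. -/
theorem card_le_card_chainTopEnds (X : Finset (EuclideanSpace ℝ (Fin 3))) {c : EuclideanSpace ℝ (Fin 3)} (hc : c ≠ 0) (hc2 : 0 ≤ c 2)
    {S : Finset (EuclideanSpace ℝ (Fin 3))} (hS : IsLaunchSet X c S) {zlo zhi : ℝ} (hzlo : ∀ b ∈ S, zlo ≤ b 2)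
    (hblock : ∀ e ∈ X, zhi < e 2 → e + c ∉ X) :
    S.card ≤ (chainTopEnds X c (fun e => zlo ≤ e 2 ∧ e 2 ≤ zhi + c 2)).card := by
  refine Finset.card_le_card_of_injOn (chainTop X hc) (fun b hb => ?_) (chainTop_injOn X hc hS)
  exact chainTop_mem_chainTopEnds X hc hc2 (hS.1 hb) (hS.2.1 b hb) (hzlo b hb) hblock

open scoped Classical in
/-- **GUARDED form of the injective count** (the blocking that plate 2 actually gives — 19481-p1 p732693 `plate_blocks_of_not_slot`: only balls in a
GUARD region `G` are blocked above `zhi`).  With blocking assumed only on `G`, every launched chain's top is a located top end at height `≥ zlo` which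
EITHER lies at height `≤ zhi + c 2` OR has its predecessor outside the guard (those tops are paid for by the rim / first-layer count, lane F's
`card_rim_window_le`). -/
theorem card_le_card_chainTopEnds_guarded (X : Finset (EuclideanSpace ℝ (Fin 3))) {c : EuclideanSpace ℝ (Fin 3)} (hc : c ≠ 0) (hc2 : 0 ≤ c 2)
    {S : Finset (EuclideanSpace ℝ (Fin 3))} (hS : IsLaunchSet X c S) {zlo zhi : ℝ} (hzlo : ∀ b ∈ S, zlo ≤ b 2)
    (G : EuclideanSpace ℝ (Fin 3) → Prop) (hblock : ∀ e ∈ X, G e → zhi < e 2 → e + c ∉ X) :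
    S.card ≤ (chainTopEnds X c (fun e => zlo ≤ e 2 ∧ (e 2 ≤ zhi + c 2 ∨ ¬ G (e - c)))).card := by
  refine Finset.card_le_card_of_injOn (chainTop X hc) (fun b hb => ?_) (chainTop_injOn X hc hS)
  have hbX : b ∈ X := hS.1 hb
  have hbc : b + c ∈ X := hS.2.1 b hb
  -- the unguarded lemma with `G := True`-blocking at a huge height gives the located-end data; redo the two height facts by hand
  have hsteps : 1 ≤ chainSteps X hc b := by
    by_contra h0
    push Not at h0
    have h00 : chainSteps X hc b = 0 := by omega
    have := chainTop_add_not_mem X hc b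
    rw [chainTop, h00] at this
    simp at this
    exact this hbc
  have htop : chainTop X hc b ∈ X := add_smul_mem_of_le_chainSteps X hc hbX le_rfl
  have hprev : chainTop X hc b - c ∈ X := by
    have h := add_smul_mem_of_le_chainSteps X hc hbX (Nat.sub_le (chainSteps X hc b) 1)
    have e : b + (((chainSteps X hc b - 1 : ℕ)) : ℝ) • c = chainTop X hc b - c := by
      rw [chainTop, Nat.cast_sub hsteps, sub_smul, Nat.cast_one, one_smul, add_sub_assoc]
    rwa [e] at h
  refine mem_chainTopEnds.2 ⟨htop, hprev, chainTop_add_not_mem X hc b, ?_, ?_⟩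
  · have : (chainTop X hc b) 2 = b 2 + (chainSteps X hc b : ℝ) * c 2 := by simp [chainTop]
    rw [this]
    nlinarith [Nat.cast_nonneg (α := ℝ) (chainSteps X hc b), hzlo b hb]
  · by_cases hG : G (chainTop X hc b - c)
    · left
      have hle : (chainTop X hc b - c) 2 ≤ zhi := by
        by_contra hlt
        push Not at hlt
        have := hblock _ hprev hG hlt
        rw [sub_add_cancel] at this
        exact this htop
      have e : (chainTop X hc b - c) 2 = (chainTop X hc b) 2 - c 2 := by simp
      linarith [e ▸ hle]
    · right; exact hG

/-! ## Payment bookkeeping -/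

open scoped Classical in
/-- **`Σ_{e ∈ E} (12 − deg e) ≥ #E − #reads`**, `reads = {e ∈ E : deg e = 12}`, for any set `E` of balls of a `1`-separated configuration (each
non-read ball is short of twelve by at least one; kissing number twelve bounds every degree).  The census instantiates `E = chainTopEnds …` and bounds
`#reads` by the twin-reading analysis (…RimSaturation, …TwinPlanePropagation, E1) and the pinning (…TerraceCensusTelescoping). -/
theorem sum_deficiency_ge_card_sub_card_reads (X : Finset (EuclideanSpace ℝ (Fin 3)))
    (hX : ∀ p ∈ X, ∀ q ∈ X, p ≠ q → 1 ≤ dist p q) (E : Finset (EuclideanSpace ℝ (Fin 3))) :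
    ((E.card : ℝ) - ((E.filter fun e => (X.filter fun q => dist e q = 1).card = 12).card : ℝ)) ≤
      ∑ e ∈ E, ((12 : ℝ) - ((X.filter fun q => dist e q = 1).card : ℝ)) := by
  have hdeg : ∀ e ∈ E, (X.filter fun q => dist e q = 1).card ≤ 12 := fun e he =>
    (isKissingAround_contacts X hX e).card_le_twelve
  -- split `E` into reads and non-reads
  have hsplit := Finset.sum_filter_add_sum_filter_not E (fun e => (X.filter fun q => dist e q = 1).card = 12)
    (fun e => (12 : ℝ) - ((X.filter fun q => dist e q = 1).card : ℝ))
  rw [← hsplit]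
  have h1 : ∑ e ∈ E.filter (fun e => (X.filter fun q => dist e q = 1).card = 12),
      ((12 : ℝ) - ((X.filter fun q => dist e q = 1).card : ℝ)) = 0 := by
    refine Finset.sum_eq_zero fun e he => ?_
    rw [(mem_filter.1 he).2]; norm_num
  have h2 : ((E.filter fun e => ¬ (X.filter fun q => dist e q = 1).card = 12).card : ℝ) ≤
      ∑ e ∈ E.filter (fun e => ¬ (X.filter fun q => dist e q = 1).card = 12),
        ((12 : ℝ) - ((X.filter fun q => dist e q = 1).card : ℝ)) := by
    have : ∀ e ∈ E.filter (fun e => ¬ (X.filter fun q => dist e q = 1).card = 12),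
        (1 : ℝ) ≤ (12 : ℝ) - ((X.filter fun q => dist e q = 1).card : ℝ) := by
      intro e he
      obtain ⟨heE, hne⟩ := mem_filter.1 he
      have hle := hdeg e heE
      have hlt : (X.filter fun q => dist e q = 1).card ≤ 11 := by omega
      have : ((X.filter fun q => dist e q = 1).card : ℝ) ≤ 11 := by exact_mod_cast hlt
      linarith
    calc ((E.filter fun e => ¬ (X.filter fun q => dist e q = 1).card = 12).card : ℝ)
        = ∑ e ∈ E.filter (fun e => ¬ (X.filter fun q => dist e q = 1).card = 12), (1 : ℝ) := by simp
      _ ≤ _ := Finset.sum_le_sum this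
  have hcard := Finset.card_filter_add_card_filter_not (s := E) (fun e => (X.filter fun q => dist e q = 1).card = 12)
  have hcardR : ((E.filter fun e => (X.filter fun q => dist e q = 1).card = 12).card : ℝ) +
      ((E.filter fun e => ¬ (X.filter fun q => dist e q = 1).card = 12).card : ℝ) = E.card := by exact_mod_cast hcard
  linarith

end Summit.Ventures.Crystal3D.Cruxes.TextureLiminf.TexShadow

end
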